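import Literature.NumberTheory.GaloisRepresentations.HasseArfCyclicDifferent
import Literature.NumberTheory.GaloisRepresentations.RamificationFiltrationQuotients
import Mathlib.Algebra.Polynomial.Degree.Support
import HarnessLib

/-!
# The different of a totally ramified extension of odd prime degree (Marcus, Ch. 4, Ex. 33)

A complement to the tree's global ramification theory (`ArtinRepresentationDifferentProofs`,
`HasseArfCyclicBasic`, `HasseArfCyclicDifferent`), in its setting: `R` Dedekind with fraction field `K`, `L/K` finite Galois
with group `G = L ≃ₐ[K] L`, `S = integralClosure R L`, `𝔓 ≠ 0` a maximal ideal of `S`.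

* Hilbert's different formula over the base `v_𝔓(𝔇_{S/R}) = Σ_{s ≠ 1} i_G(s)` at a prime fixed
  by `G` is the tree's `emultiplicity_differentIdeal_base_eq_finsum_lowerIndex`
  (`HasseArfCyclicDifferent.lean`, Serre IV §1 Prop. 4); we use it here.
* `lowerIndex_eq_two_of_prime_degree` — **Marcus, *Number Fields*, Ch. 4, Ex. 33** in global
  form: if `[L : K] = p` is an odd prime, `𝔓` is totally ramified (`T_𝔓 = G`) with finite residue
  field of characteristic `p` (`p ∈ 𝔓`) and `p ∉ 𝔭²` for `𝔭 = 𝔓 ∩ R` (absolute ramification `1`,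
  e.g. `R = ℤ`), then `i_G(s) = 2` for all `s ≠ 1` and `v_𝔓(𝔇_{S/R}) = 2(p - 1)`
  (Marcus: "`diff(R|ℤ) = P^{2(p-1)}`" for the degree-`p` abelian extension of `ℚ` ramified only
  at `p`).  Proof: `V₁ = G` (`[V₀ : V₁]` is prime to `p`,
  `relIndex_ramificationSubgroup_one_coprime_ringChar`), so Hilbert's formula reads
  `v_𝔓(𝔇) = (p-1)(t+1)` with `t ≥ 1` the unique jump; and for a uniformizer `π`,
  `f = ∏_s (X - s π)` is the minimal polynomial of `π` over `R` with lower coefficients in `𝔭`,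
  so the terms `i aᵢ π^{i-1}` of `f'(π)` have pairwise distinct `𝔓`-orders `≡ i - 1 (mod p)`
  (`mem_pow_of_sum_mem_pow`), the term `i = p` having order `v_𝔓(p) + p - 1 = 2p - 1`; as
  `f'(π) ∈ 𝔇` (Mathlib `aeval_derivative_mem_differentIdeal`), `(p-1)(t+1) ≤ 2p - 1`, forcing
  `t = 1` since `p ≥ 3`.  (For `p = 2` the jump may be `2`: `ℚ(√2)`.)

These are the inputs of Marcus, Ch. 4, Ex. 34 (an abelian extension of `ℚ` of degree `p²`
ramified only at `p` is cyclic), the key step of the Hilbert–Speiser proof of Kronecker–Weber.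

## References

* J.-P. Serre, *Local Fields*, GTM 67 (1979), Ch. III §6 Prop. 12, Ch. IV §1 Prop. 4.
  [SerreLocalFields1979]
* D. A. Marcus, *Number Fields*, 2nd ed. (2018), Ch. 4, Ex. 27 (Hilbert's formula) and Ex. 33
  (p. 102). [Marcus2018]
-/

open Polynomial
open scoped Pointwise

noncomputable section

namespace Literature.NumberTheory.GaloisRepresentations

variable (R : Type*) {K L : Type*} [CommRing R] [Field K] [Field L] [Algebra R K] [Algebra R L]
  [Algebra K L] [IsScalarTower R K L]

variable [IsDedekindDomain R] [IsFractionRing R K] [FiniteDimensional K L] [IsGalois K L]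

/-- **Residue extensions of finite residue fields are separable.**  For an `A`-algebra `B` and a
maximal ideal `P` of `B` with finite residue field, lying over a maximal ideal `𝔭 = P ∩ A`, the
residue extension `(B/P)/(A/𝔭)` is separable (`A/𝔭` is a finite field, hence perfect, and `B/P` is
finite over it). [folklore] -/
theorem isSeparable_residue_of_finite {A B : Type*} [CommRing A] [CommRing B] [Algebra A B]
    (P : Ideal B) [P.IsMaximal] [(P.under A).IsMaximal] [Finite (B ⧸ P)] :
    Algebra.IsSeparable (A ⧸ P.under A) (B ⧸ P) := by
  letI : Field (B ⧸ P) := Ideal.Quotient.field P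
  letI : Field (A ⧸ P.under A) := Ideal.Quotient.field (P.under A)
  haveI : Finite (A ⧸ P.under A) := Finite.of_injective _ Ideal.algebraMap_quotient_injective
  haveI : Algebra.IsAlgebraic (A ⧸ P.under A) (B ⧸ P) := Algebra.IsAlgebraic.of_finite _ _
  infer_instance

/-! ### The different of a totally ramified Galois extension of odd prime degree `p` over an
absolutely unramified prime of residue characteristic `p` (Marcus, Ch. 4, Ex. 33) -/

/-- **Marcus, *Number Fields*, Ch. 4, Ex. 33 (global form).**  Let `R` be Dedekind with fraction
field `K`, `L/K` Galois of odd prime degree `p`, `S = integralClosure R L`, and `𝔓 ≠ 0` a maximal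
ideal of `S` with finite residue field, which is *totally ramified* (`T_𝔓 = G`), of residue
characteristic `p` (`p ∈ 𝔓`) and such that `p ∉ 𝔭²`, `𝔭 = 𝔓 ∩ R` (e.g. `R = ℤ`).  Then every
`s ≠ 1` in `G` has `i_G(s) = 2` (the unique ramification jump is `1`), and
`v_𝔓(𝔇_{S/R}) = 2(p-1)`.  Proof (Marcus): `G = V₀ = V₁` (`[V₀ : V₁]` is prime to `p`), so by
Hilbert's formula `v_𝔓(𝔇) = (p-1)(t+1)` with `t ≥ 1` the jump; on the other hand for a uniformizer
`π` the polynomial `f = ∏_s (X - s π)` is the minimal polynomial of `π` over `R`, its lower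
coefficients lie in `𝔭`, so `f'(π) = Σ i aᵢ π^{i-1}` is a sum of terms of pairwise distinct
`𝔓`-orders `≡ i-1 (mod p)`, the term `i = p` having order `v_𝔓(p) + p - 1 = 2p-1`; hence
`v_𝔓(𝔇) ≤ v_𝔓(f'(π)) ≤ 2p-1` (`f'(π) ∈ 𝔇`), forcing `t = 1` as `p ≥ 3`.
[cite: Marcus2018, Ch. 4, Ex. 33 (p. 102)] -/
theorem lowerIndex_eq_two_of_prime_degree [IsDedekindDomain (integralClosure R L)]
    [Module.IsTorsionFree R (integralClosure R L)]
    (𝔓 : Ideal (integralClosure R L)) [𝔓.IsMaximal] (h𝔓 : 𝔓 ≠ ⊥)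
    [Finite (integralClosure R L ⧸ 𝔓)]
    {p : ℕ} (hp : p.Prime) (hp2 : p ≠ 2) (hcard : Nat.card (L ≃ₐ[K] L) = p)
    (htot : 𝔓.inertia (L ≃ₐ[K] L) = ⊤)
    (hpP : (p : integralClosure R L) ∈ 𝔓) (hp𝔭 : (p : R) ∉ (𝔓.under R) ^ 2) :
    (∀ s : L ≃ₐ[K] L, s ≠ 1 → lowerIndex 𝔓 (L ≃ₐ[K] L) s = 2) ∧
      emultiplicity 𝔓 (differentIdeal R (integralClosure R L)) = (2 * (p - 1) : ℕ) := by
  classical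
  haveI : Fintype (L ≃ₐ[K] L) := Fintype.ofFinite _
  haveI : FaithfulSMul (L ≃ₐ[K] L) (integralClosure R L) := faithfulSMul_algEquiv_integralClosure R
  haveI : IsFractionRing (integralClosure R L) L :=
    integralClosure.isFractionRing_of_finite_extension K L
  letI : Field (integralClosure R L ⧸ 𝔓) := Ideal.Quotient.field 𝔓
  haveI h𝔓prime : 𝔓.IsPrime := Ideal.IsMaximal.isPrime inferInstance
  haveI : (𝔓.under R).IsMaximal := Ideal.IsMaximal.under R 𝔓
  haveI : Algebra.IsSeparable (R ⧸ 𝔓.under R) (integralClosure R L ⧸ 𝔓) :=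
    isSeparable_residue_of_finite 𝔓
  haveI : Fact (Nat.card (L ≃ₐ[K] L)).Prime := ⟨by rw [hcard]; exact hp⟩
  have hcardF : Fintype.card (L ≃ₐ[K] L) = p := by rw [← Nat.card_eq_fintype_card, hcard]
  have hp3 : 3 ≤ p := by
    rcases hp.eq_two_or_odd' with h | h
    · exact absurd h hp2
    · have := hp.two_le; rcases h with ⟨k, hk⟩; omega
  have hstab : ∀ g : L ≃ₐ[K] L, g • 𝔓 = 𝔓 := smul_eq_of_inertia_eq_top htot
  have hV0 : 𝔓.ramificationSubgroup (L ≃ₐ[K] L) 0 = ⊤ := ramificationSubgroup_zero_eq_top R 𝔓 htot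
  -- residue characteristic `p`
  have hchar : ringChar (integralClosure R L ⧸ 𝔓) = p := by
    have h1 : ringChar (integralClosure R L ⧸ 𝔓) ∣ p := by
      refine ringChar.dvd ?_
      rw [← map_natCast (Ideal.Quotient.mk 𝔓), Ideal.Quotient.eq_zero_iff_mem]
      exact hpP
    rcases (Nat.dvd_prime hp).mp h1 with h | h
    · exact absurd h CharP.ringChar_ne_one
    · exact h
  -- Step 1: `V₁ = G`
  have hV1 : 𝔓.ramificationSubgroup (L ≃ₐ[K] L) 1 = ⊤ := by
    have hcop := relIndex_ramificationSubgroup_one_coprime_ringChar (G := L ≃ₐ[K] L) h𝔓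
    rw [hV0, Subgroup.relIndex_top_right, hchar] at hcop
    have hdvd : (𝔓.ramificationSubgroup (L ≃ₐ[K] L) 1).index ∣ p :=
      hcard ▸ Subgroup.index_dvd_card _
    exact Subgroup.index_eq_one.mp (Nat.Coprime.eq_one_of_dvd hcop hdvd)
  -- Step 2: the unique jump `t ≥ 1`: `V_t = G`, `V_{t+1} = 1`
  obtain ⟨N, hN⟩ := Ideal.ramificationSubgroup_eventually_eq_bot_holds 𝔓 (L ≃ₐ[K] L)
    (Ideal.IsMaximal.ne_top inferInstance)
  have hex : ∃ n, 𝔓.ramificationSubgroup (L ≃ₐ[K] L) n = ⊥ := ⟨N, hN N le_rfl⟩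
  have hnontriv : (⊤ : Subgroup (L ≃ₐ[K] L)) ≠ ⊥ := by
    intro h
    have h1 := Subgroup.card_top (G := L ≃ₐ[K] L)
    rw [h, Subgroup.card_bot, hcard] at h1
    exact hp.one_lt.ne h1
  have hn₀2 : 2 ≤ Nat.find hex := by
    by_contra hlt
    have hbot := Nat.find_spec hex
    rcases Nat.le_one_iff_eq_zero_or_eq_one.mp (by omega : Nat.find hex ≤ 1) with h | h
    · rw [h, hV0] at hbot; exact hnontriv hbot
    · rw [h, hV1] at hbot; exact hnontriv hbot
  set t := Nat.find hex - 1 with ht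
  have ht1 : 1 ≤ t := by omega
  have hVt : 𝔓.ramificationSubgroup (L ≃ₐ[K] L) t = ⊤ :=
    (Subgroup.eq_bot_or_eq_top_of_prime_card _).resolve_left (Nat.find_min hex (by omega))
  have hVt1 : 𝔓.ramificationSubgroup (L ≃ₐ[K] L) (t + 1) = ⊥ := by
    rw [show t + 1 = Nat.find hex by omega]; exact Nat.find_spec hex
  have hidx : ∀ s : L ≃ₐ[K] L, s ≠ 1 → lowerIndex 𝔓 (L ≃ₐ[K] L) s = ((t + 1 : ℕ) : ℕ∞) := by
    intro s hs
    apply le_antisymm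
    · rw [lowerIndex_le_natCast_iff, hVt1]
      exact fun h => hs (Subgroup.mem_bot.mp h)
    · have := add_one_le_lowerIndex 𝔓 (show s ∈ 𝔓.ramificationSubgroup (L ≃ₐ[K] L) t from
        hVt ▸ Subgroup.mem_top s)
      exact_mod_cast this
  -- Step 3: Hilbert's formula `v_𝔓(𝔇) = (p - 1)(t + 1)`
  have hHilb := emultiplicity_differentIdeal_base_eq_finsum_lowerIndex R 𝔓 h𝔓 hstab
  have hsum : ∑ᶠ (s : L ≃ₐ[K] L) (_ : s ≠ 1), lowerIndex 𝔓 (L ≃ₐ[K] L) s =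
      (((p - 1) * (t + 1) : ℕ) : ℕ∞) := by
    rw [finsum_cond_eq_sum_of_cond_iff (t := (Finset.univ : Finset (L ≃ₐ[K] L)).erase 1) _
        (fun {s} _ => by simp), Finset.sum_congr rfl fun s hs => hidx s (Finset.ne_of_mem_erase hs),
      Finset.sum_const, Finset.card_erase_of_mem (Finset.mem_univ _), Finset.card_univ, hcardF]
    push_cast
    rw [nsmul_eq_mul]
    push_cast [Nat.cast_sub hp.one_le]
    ring
  -- Step 4: the Eisenstein bound `v_𝔓(𝔇) ≤ 2p - 1`
  have hbound : ¬ (((2 * p : ℕ) : ℕ∞) ≤ emultiplicity 𝔓 (differentIdeal R (integralClosure R L))) := by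
    intro hle
    -- a uniformizer `π`; `g π ≠ π` for `g ≠ 1` as `i_G(g) = v_𝔓(g π - π) < ∞`
    obtain ⟨π, hπ, hπ2⟩ := Ideal.exists_mem_pow_notMem_pow_succ 𝔓 h𝔓
      (Ideal.IsMaximal.ne_top inferInstance) 1
    rw [pow_one] at hπ
    have hgπ : ∀ g : L ≃ₐ[K] L, g • π ∈ 𝔓 := fun g => by
      have h := Ideal.smul_mem_pointwise_smul g _ _ hπ
      rwa [hstab g] at h
    have hne1 : ∀ g : L ≃ₐ[K] L, g ≠ 1 → g • π ≠ π := fun g hg h => by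
      have h1 := lowerIndex_eq_ord_smul_sub R 𝔓 h𝔓 htot hπ hπ2 g
      rw [h, sub_self, ord_zero] at h1
      exact lowerIndex_ne_top 𝔓 (hN N le_rfl) hg h1
    have hinj : Function.Injective fun g : L ≃ₐ[K] L => g • π := by
      intro g₁ g₂ h
      have : (g₂⁻¹ * g₁) • π = π := by
        rw [mul_smul, show g₁ • π = g₂ • π from h, inv_smul_smul]
      by_contra hne
      exact hne1 (g₂⁻¹ * g₁) (fun h' => hne (inv_mul_eq_one.mp h').symm) this
    -- `Q = ∏ (X - g π)` is the minimal polynomial `P` of `π` over `R`, mapped to `S`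
    set Q : (integralClosure R L)[X] := ∏ g : L ≃ₐ[K] L, (X - C (g • π)) with hQ
    have hQmonic : Q.Monic := monic_prod_of_monic _ _ fun g _ => monic_X_sub_C _
    have hQdeg : Q.natDegree = p := by
      rw [hQ, natDegree_prod_of_monic _ _ fun g _ => monic_X_sub_C _]
      simp [hcardF]
    have hxint : IsIntegral R π := Algebra.IsIntegral.isIntegral π
    set P := minpoly R π with hP
    have hPmonic : P.Monic := minpoly.monic hxint
    have hQeq : Q = (Multiset.map (fun a => X - C a)
        ((Finset.univ : Finset (L ≃ₐ[K] L)).val.map fun g => g • π)).prod := by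
      rw [hQ, Finset.prod_eq_multiset_prod, Multiset.map_map]; rfl
    have hdvd : Q ∣ P.map (algebraMap R (integralClosure R L)) := by
      rw [hQeq, Multiset.prod_X_sub_C_dvd_iff_le_roots (hPmonic.map _).ne_zero,
        Multiset.le_iff_subset ((Finset.univ : Finset (L ≃ₐ[K] L)).nodup.map hinj)]
      intro a ha
      obtain ⟨g, -, rfl⟩ := Multiset.mem_map.mp ha
      rw [mem_roots (hPmonic.map _).ne_zero, IsRoot.def, eval_map_algebraMap, ← smul_aeval, hP,
        minpoly.aeval, smul_zero]
    have hfin : Module.finrank K L = p := by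
      rw [← IsGalois.card_aut_eq_finrank K L, hcard]
    have hPx : minpoly K (π : L) = P.map (algebraMap R K) := by
      rw [hP, ← minpoly.algebraMap_eq
        (FaithfulSMul.algebraMap_injective (integralClosure R L) L) π]
      exact minpoly.isIntegrallyClosed_eq_field_fractions' K hxint.algebraMap
    have hdegP : P.natDegree ≤ p := by
      have h1 : (minpoly K (π : L)).natDegree ≤ Module.finrank K L := minpoly.natDegree_le (π : L)
      rwa [hPx, hPmonic.natDegree_map, hfin] at h1
    have hPQ : P.map (algebraMap R (integralClosure R L)) = Q :=
      eq_of_monic_of_dvd_of_natDegree_le hQmonic (hPmonic.map _) hdvd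
        (by rw [hPmonic.natDegree_map, hQdeg]; exact hdegP)
    -- hence `π` generates `L/K`, and `P'(π) ∈ 𝔇`
    have hx : Algebra.adjoin K {((π : integralClosure R L) : L)} = ⊤ := by
      have hdeg : (minpoly K (π : L)).natDegree = Module.finrank K L := by
        rw [hPx, hPmonic.natDegree_map, hfin, ← hQdeg, ← hPQ, hPmonic.natDegree_map]
      have htop := (Field.primitive_element_iff_minpoly_natDegree_eq K (π : L)).mpr hdeg
      have halg : IsAlgebraic K (π : L) := Algebra.IsAlgebraic.isAlgebraic _
      rw [← IntermediateField.adjoin_simple_toSubalgebra_of_isAlgebraic halg, htop,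
        IntermediateField.top_toSubalgebra]
    have hmemD : aeval π (derivative P) ∈ differentIdeal R (integralClosure R L) :=
      aeval_derivative_mem_differentIdeal R K L π hx
    have hmem2 : aeval π (derivative P) ∈ 𝔓 ^ (2 * p) :=
      le_ordIdeal_iff_mem_pow.mp (hle.trans
        (emultiplicity_le_emultiplicity_of_dvd_right (Ideal.dvd_span_singleton.mpr hmemD)))
    -- `P'(π) = Σ_{n ≤ p} aₙ n π^{n-1}` with `aₙ = Q.coeff n`
    set c : ℕ → integralClosure R L := fun n => Q.coeff n * n * π ^ (n - 1) with hc
    have hexp : aeval π (derivative P) = ∑ n ∈ Finset.range (p + 1), c n := by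
      rw [← eval_map_algebraMap, ← derivative_map, hPQ, derivative_eval,
        sum_over_range' _ (fun n => by simp) (p + 1) (by rw [hQdeg]; omega)]
    -- orders of the data
    have hp𝔭' : (p : R) ∈ 𝔓.under R := by
      rw [Ideal.under_def, Ideal.mem_comap, map_natCast]; exact hpP
    have hordp : ord 𝔓 ((p : ℕ) : integralClosure R L) = p := by
      rw [← map_natCast (algebraMap R (integralClosure R L)) p,
        ord_algebraMap_eq_card_mul R 𝔓 h𝔓 htot, hcard, ord_eq_one (𝔓.under R) hp𝔭' hp𝔭, mul_one]
    have hordπ : ord 𝔓 π = 1 := ord_eq_one 𝔓 hπ hπ2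
    have hordn : ∀ n : ℕ, 0 < n → n < p → ord 𝔓 ((n : ℕ) : integralClosure R L) = 0 := by
      intro n hn0 hnp
      rw [ord_eq_zero_iff]
      intro hmem
      have hcop := (Nat.isCoprime_iff_coprime.mpr (Nat.coprime_of_lt_prime hn0.ne' hnp hp)).map
          (Int.castRingHom (integralClosure R L))
      simp only [eq_intCast, Int.cast_natCast] at hcop
      obtain ⟨a, b, hab⟩ := hcop
      apply (Ideal.IsMaximal.ne_top inferInstance : 𝔓 ≠ ⊤)
      rw [Ideal.eq_top_iff_one, ← hab]
      refine add_mem (Ideal.mul_mem_left _ _ ?_) (Ideal.mul_mem_left _ _ ?_) <;>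
        first | exact hmem | exact hpP
    have hcoeff_lt : ∀ n : ℕ, n < p → ∃ k : ℕ∞, ord 𝔓 (Q.coeff n) = p * k := by
      intro n hn
      have h1 : Q.coeff n = algebraMap R (integralClosure R L) (P.coeff n) := by
        rw [← hPQ, coeff_map]
      refine ⟨ord (𝔓.under R) (P.coeff n), ?_⟩
      rw [h1, ord_algebraMap_eq_card_mul R 𝔓 h𝔓 htot, hcard]
    have hcoeff_mem : ∀ n : ℕ, n < p → Q.coeff n ∈ 𝔓 := by
      intro n hn
      have hmapQ : Q.map (Ideal.Quotient.mk 𝔓) = X ^ p := by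
        rw [hQ, Polynomial.map_prod]
        simp only [Polynomial.map_sub, map_X, map_C, (Ideal.Quotient.eq_zero_iff_mem).mpr (hgπ _),
          map_zero, sub_zero, Finset.prod_const, Finset.card_univ, hcardF]
      have h2 := congrArg (fun q : (integralClosure R L ⧸ 𝔓)[X] => q.coeff n) hmapQ
      simp only [coeff_map, coeff_X_pow, if_neg hn.ne] at h2
      exact (Ideal.Quotient.eq_zero_iff_mem).mp h2
    have hcoeff_p : Q.coeff p = 1 := by rw [← hQdeg]; exact hQmonic.coeff_natDegree
    -- every term `c n`, `0 < n ≤ p`, has order `≡ n - 1 (mod p)`; the term `n = p` has order `2p-1`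
    have hform : ∀ n : ℕ, 0 < n → n ≤ p → ∃ k : ℕ∞, ord 𝔓 (c n) = p * k + ((n - 1 : ℕ) : ℕ∞) := by
      intro n hn0 hnp
      rcases hnp.lt_or_eq with hlt | rfl
      · obtain ⟨k, hk⟩ := hcoeff_lt n hlt
        refine ⟨k, ?_⟩
        rw [hc]
        dsimp only
        rw [ord_mul 𝔓 h𝔓, ord_mul 𝔓 h𝔓, hk, hordn n hn0 hlt, ord_pow 𝔓 h𝔓, hordπ, add_zero,
          mul_one]
      · refine ⟨1, ?_⟩
        rw [hc]
        dsimp only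
        rw [hcoeff_p, one_mul, ord_mul 𝔓 h𝔓, ord_pow 𝔓 h𝔓, hordp, hordπ, mul_one, mul_one]
    have hcp : ord 𝔓 (c p) = ((2 * p - 1 : ℕ) : ℕ∞) := by
      rw [hc]
      dsimp only
      rw [hcoeff_p, one_mul, ord_mul 𝔓 h𝔓, ord_pow 𝔓 h𝔓, hordp, hordπ, mul_one]
      norm_cast
      omega
    -- pairwise distinct orders
    have hdist : ∀ i ∈ Finset.range (p + 1), ∀ j ∈ Finset.range (p + 1),
        ord 𝔓 (c i) = ord 𝔓 (c j) → ord 𝔓 (c i) ≠ ⊤ → i = j := by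
      intro i hi j hj hij hfinite
      have hc0 : c 0 = 0 := by rw [hc]; simp
      have hi0 : i ≠ 0 := by rintro rfl; rw [hc0, ord_zero] at hfinite; exact hfinite rfl
      have hj0 : j ≠ 0 := by
        rintro rfl; rw [hij, hc0, ord_zero] at hfinite; exact hfinite rfl
      obtain ⟨ki, hki⟩ := hform i (Nat.pos_of_ne_zero hi0) (by have := Finset.mem_range.mp hi; omega)
      obtain ⟨kj, hkj⟩ := hform j (Nat.pos_of_ne_zero hj0) (by have := Finset.mem_range.mp hj; omega)
      have hki' : ki ≠ ⊤ := by rintro rfl; rw [hki] at hfinite; simp [hp.ne_zero] at hfinite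
      have hkj' : kj ≠ ⊤ := by
        rintro rfl; rw [hij, hkj] at hfinite; simp [hp.ne_zero] at hfinite
      obtain ⟨a, rfl⟩ := ENat.ne_top_iff_exists.mp hki'
      obtain ⟨b, rfl⟩ := ENat.ne_top_iff_exists.mp hkj'
      rw [hki, hkj] at hij
      have hij' : p * a + (i - 1) = p * b + (j - 1) := by exact_mod_cast hij
      have := congrArg (· % p) hij'
      simp only [Nat.mul_add_mod] at this
      have hi' := Finset.mem_range.mp hi
      have hj' := Finset.mem_range.mp hj
      rw [Nat.mod_eq_of_lt (by omega), Nat.mod_eq_of_lt (by omega)] at this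
      omega
    have hall := mem_pow_of_sum_mem_pow 𝔓 (Finset.range (p + 1)) c hdist (hexp ▸ hmem2)
    have hcp' := (mem_pow_iff_le_ord 𝔓).mp (hall p (Finset.mem_range.mpr (Nat.lt_succ_self p)))
    rw [hcp] at hcp'
    have : 2 * p ≤ 2 * p - 1 := by exact_mod_cast hcp'
    omega
  -- conclusion: `t = 1`
  have ht_eq : t = 1 := by
    rw [hHilb, hsum, not_le] at hbound
    have h1 : (p - 1) * (t + 1) < 2 * p := by exact_mod_cast hbound
    by_contra hne
    have h2 : (p - 1) * 3 ≤ (p - 1) * (t + 1) := Nat.mul_le_mul_left _ (by omega)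
    omega
  refine ⟨fun s hs => by rw [hidx s hs, ht_eq]; rfl, ?_⟩
  rw [hHilb, hsum, ht_eq]
  congr 1
  ring

end Literature.NumberTheory.GaloisRepresentations
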